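import Mathlib
import Summits.Ventures.PercRepro2.Defs
import Summits.Ventures.PercRepro2.Graph
import Summits.Ventures.PercRepro2.OneColourSwitch
import Summits.Ventures.PercRepro2.OneColourSwitchFibre
import Summits.Ventures.PercRepro2.M9PendantFibreSign
import Summits.Ventures.PercRepro2.CutVertexPaths
import Summits.Ventures.PercRepro2.CutVertexM9
import Summits.Ventures.PercRepro2.CutVertexHarrisFibre

/-!
# `m9` at a cut vertex on a typed fibre: the product formula `#fibre · Σ_Sep σ_pq σ_rs = −2·α·β`
(blind cell PercRepro2, p3 g16, 2026-08-27; `proofs/P3-CPNC.md` §13)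

The fibre version of `CutVertexM9.lean`: on a fibre `OneColourSwitch.fibre F z` (free edges `F`
coloured complementarily, the rest pinned by `z` in both colours; `W`-colour =
`OneColourSwitch.flipOn F ω`) the sign form `OneColourSwitch.m9SignSumF` satisfies, when one vertex
`v` separates `{p,q}` from `{r,s}` (`CutVertex`, a property of ALL edges, pinned ones included),
`#fibre · m9SignSumF = −2 · α_F · β_F` with `α_F = Σ_{ω ∈ fibre} 1[{p,q} ~_Y v] σ_pq(ω) ≥ 0`
(`sumFib_mul_m9SignSumF_eq`, `aInd_mul_sigmaF_sum_nonneg` — Harris with the complement on the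
fibre, `CutVertexHarrisFibre.lean`), hence `m9SignSumF ≤ 0` (`m9SignSumF_nonpos_of_cutVertex`).
The proof is the proof of `CutVertexM9.lean` with the fibre indicator carried along: the mix
involution preserves the fibre (`mix_mem_fibre_iff`), the fibre flip is an involution of the fibre.
Own work; std axioms.
-/

namespace Summit.Ventures.PercRepro2

namespace CutVertexM9

open Finset Classical

variable {V : Type*} {E : Type*}

section FibreSign

variable [Fintype E] [DecidableEq E]
variable {ends : E → Sym2 V}

/-- The indicator of the fibre. -/
noncomputable def fibInd (F : Set E) (z : Config E) (ω : Config E) : ℤ :=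
  if ω ∈ OneColourSwitch.fibre F z then 1 else 0

omit [Fintype E] [DecidableEq E] in
/-- The fibre indicator is nonnegative. -/
lemma fibInd_nonneg (F : Set E) (z : Config E) (ω : Config E) : 0 ≤ fibInd F z ω := by
  unfold fibInd
  split_ifs <;> norm_num

omit [Fintype E] [DecidableEq E] in
/-- The two-colour separation on a fibre at a cut vertex. -/
theorem sep2F_iff {side : E → Bool} {L : Set V} {v : V} {Rt : Set V}
    (h : CutVertex ends side L v Rt) {p q r s : V} (hp : p ∈ L ∨ p = v) (hq : q ∈ L ∨ q = v)
    (hr : r ∈ Rt ∨ r = v) (hs : s ∈ Rt ∨ s = v) (F : Set E) (ω : Config E) :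
    OneColourSwitch.sep2F ends F p q r s ω ↔
      (¬ ((Conn ends ω p v ∨ Conn ends ω q v) ∧ (Conn ends ω r v ∨ Conn ends ω s v))) ∧
      (¬ ((Conn ends (OneColourSwitch.flipOn F ω) p v ∨
            Conn ends (OneColourSwitch.flipOn F ω) q v) ∧
          (Conn ends (OneColourSwitch.flipOn F ω) r v ∨
            Conn ends (OneColourSwitch.flipOn F ω) s v))) := by
  unfold OneColourSwitch.sep2F
  rw [sepY_iff h hp hq hr hs ω, sepY_iff h hp hq hr hs (OneColourSwitch.flipOn F ω)]

omit [Fintype E] [DecidableEq E] in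
/-- The pointwise expansion of the fibre kernel at a cut vertex. -/
theorem kernelF_eq {side : E → Bool} {L : Set V} {v : V} {Rt : Set V}
    (h : CutVertex ends side L v Rt) {p q r s : V} (hp : p ∈ L ∨ p = v) (hq : q ∈ L ∨ q = v)
    (hr : r ∈ Rt ∨ r = v) (hs : s ∈ Rt ∨ s = v) (F : Set E) (z : Config E) (ω : Config E) :
    (if ω ∈ OneColourSwitch.fibre F z ∧ OneColourSwitch.sep2F ends F p q r s ω then
        OneColourSwitch.sigmaF ends F ω p q * OneColourSwitch.sigmaF ends F ω r s else 0) =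
      fibInd F z ω * ((1 - aInd ends p q v ω * aInd ends r s v ω) *
        (1 - aInd ends p q v (OneColourSwitch.flipOn F ω) *
          aInd ends r s v (OneColourSwitch.flipOn F ω)) *
        (OneColourSwitch.sigmaF ends F ω p q * OneColourSwitch.sigmaF ends F ω r s)) := by
  rw [sep2F_iff h hp hq hr hs F ω]
  unfold fibInd aInd
  by_cases h0 : ω ∈ OneColourSwitch.fibre F z
  · by_cases h1 : Conn ends ω p v ∨ Conn ends ω q v <;>
      by_cases h2 : Conn ends ω r v ∨ Conn ends ω s v <;>
      by_cases h3 : Conn ends (OneColourSwitch.flipOn F ω) p v ∨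
        Conn ends (OneColourSwitch.flipOn F ω) q v <;>
      by_cases h4 : Conn ends (OneColourSwitch.flipOn F ω) r v ∨
        Conn ends (OneColourSwitch.flipOn F ω) s v <;>
      simp [h0, h1, h2, h3, h4]
  · simp [h0]

omit [Fintype E] [DecidableEq E] in
/-- The fibre flip negates `σ_F`. -/
lemma sigmaF_flipOn (F : Set E) (ω : Config E) (a b : V) :
    OneColourSwitch.sigmaF ends F (OneColourSwitch.flipOn F ω) a b =
      - OneColourSwitch.sigmaF ends F ω a b := by
  simp only [OneColourSwitch.sigmaF, OneColourSwitch.flipOn_flipOn]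
  ring

omit [Fintype E] [DecidableEq E] in
/-- The fibre flip preserves the fibre indicator. -/
lemma fibInd_flipOn (F : Set E) (z : Config E) (ω : Config E) :
    fibInd F z (OneColourSwitch.flipOn F ω) = fibInd F z ω := by
  unfold fibInd
  simp only [OneColourSwitch.flipOn_mem_fibre]

/-- Reindexing a sum by the fibre flip. -/
lemma sum_flipOn (F : Set E) (G : Config E → ℤ) :
    ∑ ω, G (OneColourSwitch.flipOn F ω) = ∑ ω, G ω :=
  Equiv.sum_comp (OneColourSwitch.flipOnPerm F) G

/-- `Σ_{fibre} σ_F = 0`. -/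
lemma sumF_sigma_eq_zero (F : Set E) (z : Config E) (a b : V) :
    ∑ ω : Config E, fibInd F z ω * OneColourSwitch.sigmaF ends F ω a b = 0 := by
  have h := sum_flipOn F (fun ω : Config E => fibInd F z ω * OneColourSwitch.sigmaF ends F ω a b)
  simp only [fibInd_flipOn, sigmaF_flipOn, mul_neg, Finset.sum_neg_distrib] at h
  linarith

/-- `Σ_{fibre} a_W σ_F = −Σ_{fibre} a_Y σ_F`. -/
lemma sumF_aInd_flipOn_mul_sigmaF (F : Set E) (z : Config E) (a b c : V) :
    ∑ ω : Config E, fibInd F z ω * (aInd ends a b c (OneColourSwitch.flipOn F ω) *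
      OneColourSwitch.sigmaF ends F ω a b) =
      - ∑ ω : Config E, fibInd F z ω * (aInd ends a b c ω * OneColourSwitch.sigmaF ends F ω a b) := by
  have h := sum_flipOn F (fun ω : Config E => fibInd F z ω *
    (aInd ends a b c (OneColourSwitch.flipOn F ω) * OneColourSwitch.sigmaF ends F ω a b))
  simp only [fibInd_flipOn, OneColourSwitch.flipOn_flipOn, sigmaF_flipOn, mul_neg,
    Finset.sum_neg_distrib] at h
  linarith

/-- `Σ_{fibre} a_Y a_W σ_F = 0`. -/
lemma sumF_aInd_mul_aInd_flipOn_mul_sigmaF (F : Set E) (z : Config E) (a b c : V) :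
    ∑ ω : Config E, fibInd F z ω * (aInd ends a b c ω *
      aInd ends a b c (OneColourSwitch.flipOn F ω) * OneColourSwitch.sigmaF ends F ω a b) = 0 := by
  have h := sum_flipOn F (fun ω : Config E => fibInd F z ω * (aInd ends a b c ω *
    aInd ends a b c (OneColourSwitch.flipOn F ω) * OneColourSwitch.sigmaF ends F ω a b))
  simp only [fibInd_flipOn, OneColourSwitch.flipOn_flipOn, sigmaF_flipOn, mul_neg,
    Finset.sum_neg_distrib] at h
  have h2 : ∑ ω : Config E, fibInd F z ω * (aInd ends a b c (OneColourSwitch.flipOn F ω) *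
      aInd ends a b c ω * OneColourSwitch.sigmaF ends F ω a b) =
      ∑ ω : Config E, fibInd F z ω * (aInd ends a b c ω *
        aInd ends a b c (OneColourSwitch.flipOn F ω) * OneColourSwitch.sigmaF ends F ω a b) :=
    Finset.sum_congr rfl (fun ω _ => by ring)
  linarith

omit [Fintype E] [DecidableEq E] in
/-- The mix of two configurations lies in the fibre (with its mirror) iff both do. -/
lemma mix_mem_fibre_iff (F : Set E) (z : Config E) (side : E → Bool) (ω ω' : Config E) :
    (mix side ω ω' ∈ OneColourSwitch.fibre F z ∧ mix side ω' ω ∈ OneColourSwitch.fibre F z) ↔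
      (ω ∈ OneColourSwitch.fibre F z ∧ ω' ∈ OneColourSwitch.fibre F z) := by
  simp only [OneColourSwitch.fibre, Set.mem_setOf_eq]
  constructor
  · rintro ⟨h1, h2⟩
    refine ⟨fun e he => ?_, fun e he => ?_⟩
    · have a1 := h1 e he
      have a2 := h2 e he
      simp only [mix] at a1 a2
      by_cases hs : side e = true
      · rw [if_pos hs] at a1; exact a1
      · rw [if_neg hs] at a2; exact a2
    · have a1 := h1 e he
      have a2 := h2 e he
      simp only [mix] at a1 a2
      by_cases hs : side e = true
      · rw [if_pos hs] at a2; exact a2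
      · rw [if_neg hs] at a1; exact a1
  · rintro ⟨h1, h2⟩
    refine ⟨fun e he => ?_, fun e he => ?_⟩
    · simp only [mix]
      split_ifs
      · exact h1 e he
      · exact h2 e he
    · simp only [mix]
      split_ifs
      · exact h2 e he
      · exact h1 e he

omit [Fintype E] [DecidableEq E] in
/-- The fibre indicator of the mixed pair is the product of the fibre indicators. -/
lemma fibInd_mix (F : Set E) (z : Config E) (side : E → Bool) (ω ω' : Config E) :
    fibInd F z (mix side ω ω') * fibInd F z (mix side ω' ω) = fibInd F z ω * fibInd F z ω' := by
  have key := mix_mem_fibre_iff F z side ω ω'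
  unfold fibInd
  by_cases h1 : mix side ω ω' ∈ OneColourSwitch.fibre F z <;>
    by_cases h2 : mix side ω' ω ∈ OneColourSwitch.fibre F z <;>
    by_cases h3 : ω ∈ OneColourSwitch.fibre F z <;>
    by_cases h4 : ω' ∈ OneColourSwitch.fibre F z <;> simp_all

/-- **Factorisation on the fibre.** If `f` reads only the edges of side `true` and `g` only those
of side `false`, then `(Σ_{fibre} f g) · #fibre = (Σ_{fibre} f) · (Σ_{fibre} g)`. -/
theorem sumF_mul_mul (F : Set E) (z : Config E) (side : E → Bool) (f g : Config E → ℤ)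
    (hf : ∀ ω ω', (∀ e, side e = true → ω e = ω' e) → f ω = f ω')
    (hg : ∀ ω ω', (∀ e, side e = false → ω e = ω' e) → g ω = g ω') :
    (∑ ω, fibInd F z ω * (f ω * g ω)) * (∑ ω, fibInd F z ω) =
      (∑ ω, fibInd F z ω * f ω) * (∑ ω, fibInd F z ω * g ω) := by
  have hmix1 : ∀ ω ω', f (mix side ω ω') = f ω :=
    fun ω ω' => hf _ _ (fun e he => by simp [mix, he])
  have hmix2 : ∀ ω ω', g (mix side ω ω') = g ω' :=
    fun ω ω' => hg _ _ (fun e he => by simp [mix, he])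
  calc (∑ ω, fibInd F z ω * (f ω * g ω)) * (∑ ω, fibInd F z ω)
      = ∑ ω, ∑ ω', (fibInd F z ω * (f ω * g ω)) * fibInd F z ω' := by
        rw [Finset.sum_mul_sum]
    _ = ∑ x : Config E × Config E, (fibInd F z x.1 * (f x.1 * g x.1)) * fibInd F z x.2 := by
        rw [Fintype.sum_prod_type]
    _ = ∑ x : Config E × Config E, (fibInd F z (mixPerm side x).1 *
          (f (mixPerm side x).1 * g (mixPerm side x).1)) * fibInd F z (mixPerm side x).2 :=
        (Equiv.sum_comp (mixPerm side) (fun x : Config E × Config E =>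
          (fibInd F z x.1 * (f x.1 * g x.1)) * fibInd F z x.2)).symm
    _ = ∑ x : Config E × Config E, (fibInd F z x.1 * f x.1) * (fibInd F z x.2 * g x.2) := by
        refine Finset.sum_congr rfl fun x _ => ?_
        simp only [mixPerm, Function.Involutive.coe_toPerm, hmix1, hmix2]
        have := fibInd_mix F z side x.1 x.2
        linear_combination (f x.1 * g x.2) * this
    _ = (∑ ω, fibInd F z ω * f ω) * (∑ ω, fibInd F z ω * g ω) := by
        rw [Fintype.sum_prod_type, Finset.sum_mul_sum]

/-- **`α_F ≥ 0`**: `Σ_{ω ∈ fibre} 1[{a,b} ~_Y c] · σ_F(ω) ≥ 0` on every fibre of every multigraph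
(Harris with the complement on the fibre). -/
theorem aInd_mul_sigmaF_sum_nonneg (ends : E → Sym2 V) (F : Set E) (z : Config E) (a b c : V) :
    0 ≤ ∑ ω : Config E, fibInd F z ω * (aInd ends a b c ω * OneColourSwitch.sigmaF ends F ω a b) := by
  have hA : IsUpperSet (connEvent ends a b) := isUpperSet_connEvent ends a b
  have hB : IsUpperSet (connEvent ends a c ∪ connEvent ends b c) :=
    (isUpperSet_connEvent ends a c).union (isUpperSet_connEvent ends b c)
  have key := card_filter_le_of_isUpperSet_fibre F z hA hB
    (fun ω => ω ∈ OneColourSwitch.fibre F z ∧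
      (Conn ends ω a b ∧ (Conn ends ω a c ∨ Conn ends ω b c)))
    (fun ω => ω ∈ OneColourSwitch.fibre F z ∧
      ((Conn ends ω a c ∨ Conn ends ω b c) ∧ Conn ends (OneColourSwitch.flipOn F ω) a b))
    (fun ω => by simp only [connEvent, Set.mem_inter_iff, Set.mem_union, Set.mem_setOf_eq])
    (fun ω => by simp only [connEvent, Set.mem_union, Set.mem_setOf_eq])
  have hsum : ∑ ω : Config E, fibInd F z ω *
      (aInd ends a b c ω * OneColourSwitch.sigmaF ends F ω a b) =
      ∑ ω : Config E, ((if ω ∈ OneColourSwitch.fibre F z ∧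
          (Conn ends ω a b ∧ (Conn ends ω a c ∨ Conn ends ω b c)) then (1 : ℤ) else 0) -
        (if ω ∈ OneColourSwitch.fibre F z ∧
          ((Conn ends ω a c ∨ Conn ends ω b c) ∧ Conn ends (OneColourSwitch.flipOn F ω) a b) then
          (1 : ℤ) else 0)) := by
    refine Finset.sum_congr rfl fun ω _ => ?_
    unfold fibInd aInd OneColourSwitch.sigmaF
    by_cases h0 : ω ∈ OneColourSwitch.fibre F z <;>
      by_cases h1 : Conn ends ω a c ∨ Conn ends ω b c <;> by_cases h2 : Conn ends ω a b <;>
      by_cases h3 : Conn ends (OneColourSwitch.flipOn F ω) a b <;> simp [h0, h1, h2, h3]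
  rw [hsum, Finset.sum_sub_distrib, Finset.sum_boole, Finset.sum_boole]
  have key' : ((univ.filter (fun ω : Config E => ω ∈ OneColourSwitch.fibre F z ∧
      ((Conn ends ω a c ∨ Conn ends ω b c) ∧
        Conn ends (OneColourSwitch.flipOn F ω) a b))).card : ℤ) ≤
      ((univ.filter (fun ω : Config E => ω ∈ OneColourSwitch.fibre F z ∧
        (Conn ends ω a b ∧ (Conn ends ω a c ∨ Conn ends ω b c)))).card : ℤ) := by
    exact_mod_cast key
  linarith

end FibreSign

section Main

variable [Fintype E] [DecidableEq E]
variable {ends : E → Sym2 V} {side : E → Bool} {L : Set V} {v : V} {Rt : Set V}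

omit [Fintype E] [DecidableEq E] in
/-- Agreement on a side passes to the fibre flips. -/
lemma flipOn_agree {F : Set E} {b : Bool} {ω ω' : Config E}
    (hag : ∀ e, side e = b → ω e = ω' e) :
    ∀ e, side e = b → OneColourSwitch.flipOn F ω e = OneColourSwitch.flipOn F ω' e :=
  fun e he => by simp [OneColourSwitch.flipOn, hag e he]

omit [Fintype E] [DecidableEq E] in
/-- `σ_F(pq)` reads only the left edges. -/
lemma sigmaF_congr_left (h : CutVertex ends side L v Rt) {p q : V} (hp : p ∈ L ∨ p = v)
    (hq : q ∈ L ∨ q = v) (F : Set E) {ω ω' : Config E}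
    (hag : ∀ e, side e = true → ω e = ω' e) :
    OneColourSwitch.sigmaF ends F ω p q = OneColourSwitch.sigmaF ends F ω' p q := by
  unfold OneColourSwitch.sigmaF
  rw [conn_left_congr h hp hq hag, conn_left_congr h hp hq (flipOn_agree hag)]

omit [Fintype E] [DecidableEq E] in
/-- `σ_F(rs)` reads only the right edges. -/
lemma sigmaF_congr_right (h : CutVertex ends side L v Rt) {r s : V} (hr : r ∈ Rt ∨ r = v)
    (hs : s ∈ Rt ∨ s = v) (F : Set E) {ω ω' : Config E}
    (hag : ∀ e, side e = false → ω e = ω' e) :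
    OneColourSwitch.sigmaF ends F ω r s = OneColourSwitch.sigmaF ends F ω' r s := by
  unfold OneColourSwitch.sigmaF
  rw [conn_right_congr h hr hs hag, conn_right_congr h hr hs (flipOn_agree hag)]

/-- **The product formula on a fibre**:
`#fibre · m9SignSumF = −2 · (Σ_{fibre} a_Y σ_pq) · (Σ_{fibre} b_Y σ_rs)`. -/
theorem sumFib_mul_m9SignSumF_eq (h : CutVertex ends side L v Rt) {p q r s : V}
    (hp : p ∈ L ∨ p = v) (hq : q ∈ L ∨ q = v) (hr : r ∈ Rt ∨ r = v) (hs : s ∈ Rt ∨ s = v)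
    (F : Set E) (z : Config E) :
    (∑ ω : Config E, fibInd F z ω) * OneColourSwitch.m9SignSumF ends F z p q r s =
      -2 * (∑ ω : Config E, fibInd F z ω *
          (aInd ends p q v ω * OneColourSwitch.sigmaF ends F ω p q)) *
        (∑ ω : Config E, fibInd F z ω *
          (aInd ends r s v ω * OneColourSwitch.sigmaF ends F ω r s)) := by
  have hker : ∀ ω : Config E,
      (if ω ∈ OneColourSwitch.fibre F z ∧ OneColourSwitch.sep2F ends F p q r s ω then
        OneColourSwitch.sigmaF ends F ω p q * OneColourSwitch.sigmaF ends F ω r s else 0) =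
      fibInd F z ω * (OneColourSwitch.sigmaF ends F ω p q * OneColourSwitch.sigmaF ends F ω r s)
      - fibInd F z ω * ((aInd ends p q v ω * OneColourSwitch.sigmaF ends F ω p q) *
          (aInd ends r s v ω * OneColourSwitch.sigmaF ends F ω r s))
      - fibInd F z ω * ((aInd ends p q v (OneColourSwitch.flipOn F ω) *
            OneColourSwitch.sigmaF ends F ω p q) *
          (aInd ends r s v (OneColourSwitch.flipOn F ω) * OneColourSwitch.sigmaF ends F ω r s))
      + fibInd F z ω * ((aInd ends p q v ω * aInd ends p q v (OneColourSwitch.flipOn F ω) *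
            OneColourSwitch.sigmaF ends F ω p q) *
          (aInd ends r s v ω * aInd ends r s v (OneColourSwitch.flipOn F ω) *
            OneColourSwitch.sigmaF ends F ω r s)) := by
    intro ω
    rw [kernelF_eq h hp hq hr hs F z ω]
    ring
  have i1 := sumF_mul_mul F z side (fun ω => OneColourSwitch.sigmaF ends F ω p q)
    (fun ω => OneColourSwitch.sigmaF ends F ω r s)
    (fun ω ω' hag => sigmaF_congr_left h hp hq F hag)
    (fun ω ω' hag => sigmaF_congr_right h hr hs F hag)
  have i2 := sumF_mul_mul F z side
    (fun ω => aInd ends p q v ω * OneColourSwitch.sigmaF ends F ω p q)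
    (fun ω => aInd ends r s v ω * OneColourSwitch.sigmaF ends F ω r s)
    (fun ω ω' hag => by rw [aInd_congr_left h hp hq hag, sigmaF_congr_left h hp hq F hag])
    (fun ω ω' hag => by rw [aInd_congr_right h hr hs hag, sigmaF_congr_right h hr hs F hag])
  have i3 := sumF_mul_mul F z side
    (fun ω => aInd ends p q v (OneColourSwitch.flipOn F ω) * OneColourSwitch.sigmaF ends F ω p q)
    (fun ω => aInd ends r s v (OneColourSwitch.flipOn F ω) * OneColourSwitch.sigmaF ends F ω r s)
    (fun ω ω' hag => by
      rw [aInd_congr_left h hp hq (flipOn_agree hag), sigmaF_congr_left h hp hq F hag])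
    (fun ω ω' hag => by
      rw [aInd_congr_right h hr hs (flipOn_agree hag), sigmaF_congr_right h hr hs F hag])
  have i4 := sumF_mul_mul F z side
    (fun ω => aInd ends p q v ω * aInd ends p q v (OneColourSwitch.flipOn F ω) *
      OneColourSwitch.sigmaF ends F ω p q)
    (fun ω => aInd ends r s v ω * aInd ends r s v (OneColourSwitch.flipOn F ω) *
      OneColourSwitch.sigmaF ends F ω r s)
    (fun ω ω' hag => by
      rw [aInd_congr_left h hp hq hag, aInd_congr_left h hp hq (flipOn_agree hag),
        sigmaF_congr_left h hp hq F hag])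
    (fun ω ω' hag => by
      rw [aInd_congr_right h hr hs hag, aInd_congr_right h hr hs (flipOn_agree hag),
        sigmaF_congr_right h hr hs F hag])
  have f1 := sumF_sigma_eq_zero (ends := ends) F z p q
  have f2 := sumF_aInd_flipOn_mul_sigmaF (ends := ends) F z p q v
  have f3 := sumF_aInd_flipOn_mul_sigmaF (ends := ends) F z r s v
  have f4 := sumF_aInd_mul_aInd_flipOn_mul_sigmaF (ends := ends) F z p q v
  rw [f1, zero_mul] at i1
  rw [f2, f3] at i3
  rw [f4, zero_mul] at i4
  unfold OneColourSwitch.m9SignSumF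
  simp only [hker, Finset.sum_add_distrib, Finset.sum_sub_distrib]
  linear_combination i1 - i2 - i3 + i4

/-- **`m9` on every fibre at a cut vertex**: `m9SignSumF ≤ 0`. -/
theorem m9SignSumF_nonpos_of_cutVertex (h : CutVertex ends side L v Rt) {p q r s : V}
    (hp : p ∈ L ∨ p = v) (hq : q ∈ L ∨ q = v) (hr : r ∈ Rt ∨ r = v) (hs : s ∈ Rt ∨ s = v)
    (F : Set E) (z : Config E) :
    OneColourSwitch.m9SignSumF ends F z p q r s ≤ 0 := by
  have hz : z ∈ OneColourSwitch.fibre F z := fun _ _ => rfl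
  have h1 : fibInd F z z = 1 := by
    unfold fibInd
    rw [if_pos hz]
  have hN : (0 : ℤ) < ∑ ω : Config E, fibInd F z ω := by
    have := Finset.single_le_sum (fun ω _ => fibInd_nonneg F z ω) (Finset.mem_univ z)
    linarith
  have key := sumFib_mul_m9SignSumF_eq h hp hq hr hs F z
  have hα := aInd_mul_sigmaF_sum_nonneg ends F z p q v
  have hβ := aInd_mul_sigmaF_sum_nonneg ends F z r s v
  have hprod : (∑ ω : Config E, fibInd F z ω) * OneColourSwitch.m9SignSumF ends F z p q r s ≤ 0 := by
    rw [key]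
    nlinarith [mul_nonneg hα hβ]
  rcases le_or_gt (OneColourSwitch.m9SignSumF ends F z p q r s) 0 with hle | hlt
  · exact hle
  · exfalso
    have := mul_pos hN hlt
    linarith

end Main

end CutVertexM9

end Summit.Ventures.PercRepro2
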